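import Literature.NumberTheory.EllipticCurves.KleinFrickeLevelNine
import Literature.NumberTheory.EllipticCurves.KleinFrickeLevelThirteen
import Literature.NumberTheory.EllipticCurves.KubertTateThirteen
import Literature.NumberTheory.EllipticCurves.GaloisAction
import HarnessLib

/-!
# STUB-IDEAS companion — `stub_pasten163`, ideator k = 1, generation 7 (FAMILY 1: RECOGNISE & IMPORT)

Crux `stmt-ABC-11338` (`DefiniteXi.DefiniteRTControlPrime`), skeleton `Lines/Sketch.lean`,
stub `stub_pasten163 : PastenShimura2024_minimalDegree_le_163_mul`.

This file is the gen-7 delta to `STUB_IDEAS_stub_pasten163_1g6.lean` (same directory; not imported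
here because its olean is not built on the farm today — `remote:stale:unbuilt`): the Galois-descent
step **B6** of the in-tree discharge of `kleinFrickeThirteen_exists_j_eq` (KF13) is RESTRUCTURED so
that the descent has ONE case instead of the twelve `interval_cases` words of the level-9 template
`exists_hauptmodul_nine_of_torsion`:

* `hauptPt W P` — the Hauptmodul `τ` of `X₀(13)` read at a POINT (`0 ↦ 0` junk value);
* **G1** (`decide`, PROVED) every `k ∈ (ℤ/13)ˣ` is `4^a 5^b` (so `-1 = 4³`: no `negY` lemmas needed);
* **G4/G5** (M, `sorry`) `τ(4P) = τ(P)`, `τ(5P) = τ(P)` for `P` of order `13` — these are g6's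
  B3core₄/₅ + B4₄/₅ (rational identities modulo `F₁₃`, cofactors 52/32/87/88 and 123/72 monomials)
  read through the chart N1–N3 below;
* **G6** (PROVED from G1, G4, G5) `τ(kP) = τ(P)` for every `k` with `13 ∤ k`;
* **G7** (PROVED) `σ(τ(P)) = τ(σP)`;  **G8** (PROVED from G6, G7) `τ(P)` is `Gal(L/F)`-fixed when `ℤP` is stable;
* **N1** (S–M, `sorry`) the level-13 Tate-normal-form chart, a verbatim port of the LANDED level-7
  `exists_variableChange_eq_kubertTate_diag₇_of_addOrderOf_eq_seven`; **N2** (PROVED) `(r, s)` at the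
  origin of `E(rs(r-1), s(r-1))`; **N3** (S, `sorry`) `(r, s)(P)` = the chart parameters.

What remains for provers after this file: N1, N3, G4, G5 (all S–M, every input named), g6's B5
(`j·τ = (τ²+5τ+13)(τ⁴+7τ³+20τ²+19τ+1)³` mod `F₁₃`, kernel certificate, 2187-monomial cofactor —
HARDEST) and the final packaging B6′ (S–M).  Quick refuter run this session (local, seconds;
`scratch/check_tau_orbit.py` in the seat folder): on 160 curves `E(rs(r-1), s(r-1))/F_p`,
`p ∈ {101, 1009, 10007, 30011}`, `F₁₃(r,s) = 0`: `τ(kP) = τ(P)` for ALL `k = 1..12`,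
`F₁₃(r(kP), s(kP)) = 0`, `(r,s)(0,0) = (r,s)` (N2), `(r,s)(4P) = α₄`, `(r,s)(5P) = α₅`,
`j·τ = G₁₃(τ)` — 160/160.

`lean check`: rc 0; `sorry` only in the helper bodies N1, N3, G4, G5, B6′.
-/

noncomputable section

open scoped Classical

universe u

namespace WeierstrassCurve.KF13

variable {F : Type u} [Field F] (W : WeierstrassCurve F) {L : Type u} [Field L] [Algebra F L]

/-! ## Coordinates (copies of g6 B1/B4 with the same bodies, namespaced `KF13` to avoid clashes) -/

/-- Sutherland's `r = b/c` at the marked point `(x, y)` (g6 `tateR`; `s` IS the tree's `tateNine`).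
[cite: Sutherland2012, §2] -/
def tateR (x y : F) : F :=
  -(W.tgA₂ x y) ^ 3 / (W.tgA₃ x y * (W.tgA₃ x y - W.tgA₁ x y * W.tgA₂ x y))

/-- Numerator of the Hauptmodul `τ` of `X₀(13)` on the raw `X₁(13)` (g6, job j344759). -/
def hauptNum (r s : F) : F :=
  (s - 1) * ((r - 1) ^ 2 * s ^ 3 + (-8 * r ^ 2 + 5 * r + 3) * s ^ 2 + (16 * r ^ 2 - 20 * r + 3) * s + 1)

/-- Denominator of `τ`. -/
def hauptDen (r s : F) : F :=
  r * s ^ 4 + (r ^ 2 - 3 * r) * s ^ 3 + (-5 * r ^ 2 + 6 * r) * s ^ 2 + (6 * r ^ 2 - 7 * r + 1) * s +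
    (-r ^ 2 + r)

/-- `τ = hauptNum / hauptDen` with `j · τ = (τ²+5τ+13)(τ⁴+7τ³+20τ²+19τ+1)³` on `F₁₃ = 0`.
[cite: Maier2009, Table 4 (N = 13)] -/
def haupt (r s : F) : F := hauptNum r s / hauptDen r s

/-- **`τ` at a point**: `τ(P) := τ(r(P), s(P))`, junk value `0` at `P = 0`. -/
def hauptPt : W.toAffine.Point → F
  | .zero => 0
  | .some x y _ => haupt (tateR W x y) (W.tateNine x y)

@[simp] theorem hauptPt_zero : hauptPt W (0 : W.toAffine.Point) = 0 := rfl

@[simp] theorem hauptPt_some {x y : F} (h : W.toAffine.Nonsingular x y) :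
    hauptPt W (.some x y h) = haupt (tateR W x y) (W.tateNine x y) := rfl

/-! ## G1 — the combinatorial core of the descent (`decide`) -/

/-- **G1 — PROVED.** `(ℤ/13)ˣ = {4^a 5^b}` (`4` has order `6`, `5` has order `4`; `-1 = 4³`). -/
theorem units13_eq_pow_four_mul_pow_five :
    ∀ k : ZMod 13, k ≠ 0 → ∃ a : Fin 6, ∃ b : Fin 4, (4 : ZMod 13) ^ (a : ℕ) * 5 ^ (b : ℕ) = k := by
  decide

theorem not_thirteen_dvd_pow_mul_pow (a b : ℕ) : ¬ 13 ∣ 4 ^ a * 5 ^ b := by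
  have hp : Nat.Prime 13 := by decide
  intro h
  rcases hp.dvd_mul.mp h with h | h
  · have := hp.dvd_of_dvd_pow h; omega
  · have := hp.dvd_of_dvd_pow h; omega

variable {W}

/-- A multiple `mP` with `13 ∤ m` of a point of order `13` has order `13`. -/
theorem addOrderOf_nsmul_eq_thirteen {P : W.toAffine.Point} (h13 : addOrderOf P = 13) {m : ℕ}
    (hm : ¬ 13 ∣ m) : addOrderOf (m • P) = 13 := by
  have hc : (addOrderOf P).Coprime m := by
    rw [h13]; exact (Nat.Prime.coprime_iff_not_dvd (by decide)).mpr hm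
  rw [hc.addOrderOf_nsmul, h13]

/-! ## G4 / G5 (M) — deck invariance of `τ` at point level (g6 B3 + B4 through the chart N1–N3) -/

/-- **G4 (M).** `τ(4P) = τ(P)` for `P` of order `13` on any `W/F` (no ellipticity needed: the
denominators are cusp units, nonzero by g6 B7b `cuspUnits_ne_zero_of_kubertTateRaw₁₃`).
Proof plan: chart N1 (`P ↦ (0,0)` on `E(rs(r-1), s(r-1))`, additive), `4·(0,0) = (r(r-1), r²(r-1)(s-1))`
(`kubertTate_four_nsmul_zero`), `(r,s)` is a `VariableChange` invariant (g6 B1′ `tateR_toXY'`,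
`tateNine_toXY'`), g6 B3core₄ `(r,s)(4·(0,0)) = α₄(r,s)` and B4₄ `τ ∘ α₄ = τ`, then N3. -/
theorem hauptPt_four_nsmul {P : W.toAffine.Point} (h13 : addOrderOf P = 13) :
    hauptPt W ((4 : ℕ) • P) = hauptPt W P := by
  sorry

/-- **G5 (M).** `τ(5P) = τ(P)` (`5·(0,0) = (rs(s-1), rs²(r-s))`, g6 B3core₅ + B4₅). -/
theorem hauptPt_five_nsmul {P : W.toAffine.Point} (h13 : addOrderOf P = 13) :
    hauptPt W ((5 : ℕ) • P) = hauptPt W P := by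
  sorry

/-! ## G6 — PROVED from G1, G4, G5: `τ(kP) = τ(P)` for all `k` prime to `13` -/

theorem hauptPt_pow_nsmul {P : W.toAffine.Point} (h13 : addOrderOf P = 13) (a b : ℕ) :
    hauptPt W ((4 ^ a * 5 ^ b) • P) = hauptPt W P := by
  induction a with
  | zero =>
    induction b with
    | zero => simp
    | succ b ih =>
      have e : 4 ^ 0 * 5 ^ (b + 1) = 5 * (4 ^ 0 * 5 ^ b) := by ring
      rw [e, mul_smul, hauptPt_five_nsmul
        (addOrderOf_nsmul_eq_thirteen h13 (not_thirteen_dvd_pow_mul_pow 0 b)), ih]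
  | succ a ih =>
    have e : 4 ^ (a + 1) * 5 ^ b = 4 * (4 ^ a * 5 ^ b) := by ring
    rw [e, mul_smul, hauptPt_four_nsmul
      (addOrderOf_nsmul_eq_thirteen h13 (not_thirteen_dvd_pow_mul_pow a b)), ih]

/-- **G6 — PROVED (modulo G4, G5).** The whole deck group fixes `τ(P)`: ONE statement replacing
the twelve-case analysis of the level-9 template. -/
theorem hauptPt_nsmul_of_not_dvd {P : W.toAffine.Point} (h13 : addOrderOf P = 13) {k : ℕ}
    (hk : ¬ 13 ∣ k) : hauptPt W (k • P) = hauptPt W P := by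
  have hk' : (k : ZMod 13) ≠ 0 := by
    rw [Ne, ZMod.natCast_eq_zero_iff]; exact hk
  obtain ⟨a, b, hab⟩ := units13_eq_pow_four_mul_pow_five k hk'
  have hmod : (4 ^ (a : ℕ) * 5 ^ (b : ℕ)) % 13 = k % 13 := by
    have h : ((4 ^ (a : ℕ) * 5 ^ (b : ℕ) : ℕ) : ZMod 13) = (k : ZMod 13) := by
      push_cast; exact hab
    exact (ZMod.natCast_eq_natCast_iff' _ _ _).mp h
  have e1 := mod_addOrderOf_nsmul P k
  have e2 := mod_addOrderOf_nsmul P (4 ^ (a : ℕ) * 5 ^ (b : ℕ))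
  rw [h13] at e1 e2
  rw [← e1, ← hmod, e2, hauptPt_pow_nsmul h13]

/-! ## G7 — PROVED: Galois equivariance of `τ(P)` -/

theorem map_tateR (σ : L →ₐ[F] L) (x y : L) :
    σ (tateR (W.baseChange L) x y) = tateR (W.baseChange L) (σ x) (σ y) := by
  have ha₁ : σ (W.baseChange L).a₁ = (W.baseChange L).a₁ := σ.commutes W.a₁
  have ha₂ : σ (W.baseChange L).a₂ = (W.baseChange L).a₂ := σ.commutes W.a₂
  simp only [tateR, tgA₁, tgA₂, tgA₃, map_div₀, map_neg, map_pow, map_sub, map_add, map_mul,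
    map_ofNat, ha₁, ha₂, Affine.baseChange_slope, Affine.baseChange_negY]

theorem map_haupt (σ : L →ₐ[F] L) (r s : L) : σ (haupt r s) = haupt (σ r) (σ s) := by
  simp only [haupt, hauptNum, hauptDen, map_div₀, map_neg, map_pow, map_sub, map_add, map_mul,
    map_ofNat, map_one]

/-- **G7 — PROVED.** `σ(τ(P)) = τ(σP)`. -/
theorem map_hauptPt (σ : L ≃ₐ[F] L) (P : (W.baseChange L).toAffine.Point) :
    σ (hauptPt (W.baseChange L) P) = hauptPt (W.baseChange L) (σ • P) := by
  rcases P with _ | ⟨x, y, h⟩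
  · have e : σ • (Affine.Point.zero : (W.baseChange L).toAffine.Point) = .zero := by
      rw [← Affine.Point.zero_def]; exact smul_zero σ
    rw [e]
    simp [hauptPt]
  · change (σ : L →ₐ[F] L) _ =
      hauptPt _ (Affine.Point.map (σ : L →ₐ[F] L) (Affine.Point.some x y h))
    rw [Affine.Point.map_some, hauptPt_some, hauptPt_some, map_haupt, map_tateR (W := W),
      map_tateNine (W := W)]

/-! ## G8 — PROVED from G6, G7: `τ(P)` is Galois-fixed when `ℤP` is Galois-stable -/

/-- **G8 — PROVED (modulo G4, G5).** The ONE-case descent. -/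
theorem hauptPt_fixed_of_stable {P : (W.baseChange L).toAffine.Point} (h13 : addOrderOf P = 13)
    (hσ : ∀ σ : L ≃ₐ[F] L, σ • P ∈ AddSubgroup.zmultiples P) (σ : L ≃ₐ[F] L) :
    σ (hauptPt (W.baseChange L) P) = hauptPt (W.baseChange L) P := by
  rw [map_hauptPt]
  obtain ⟨n, hn⟩ := AddSubgroup.mem_zmultiples_iff.mp (hσ σ)
  have hmod := mod_addOrderOf_zsmul P n
  rw [h13] at hmod
  push_cast at hmod
  obtain ⟨m, hm⟩ : ∃ m : ℕ, (m : ℤ) = n % 13 :=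
    ⟨(n % 13).toNat, Int.toNat_of_nonneg (Int.emod_nonneg _ (by norm_num))⟩
  have hσP : σ • P = m • P := by
    rw [← hn, ← hmod, ← hm, natCast_zsmul]
  have hm13 : ¬ 13 ∣ m := by
    intro hd
    have h0 : m • P = 0 := addOrderOf_dvd_iff_nsmul_eq_zero.mp (h13 ▸ hd)
    rw [h0] at hσP
    have hP : P = 0 := (smul_eq_zero_iff_eq σ).mp hσP
    rw [hP, addOrderOf_zero] at h13
    omega
  rw [hσP, hauptPt_nsmul_of_not_dvd h13 hm13]

/-- Hence `τ(P) ∈ F`. -/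
theorem exists_algebraMap_eq_hauptPt [IsGalois F L] {P : (W.baseChange L).toAffine.Point}
    (h13 : addOrderOf P = 13) (hσ : ∀ σ : L ≃ₐ[F] L, σ • P ∈ AddSubgroup.zmultiples P) :
    ∃ t : F, algebraMap F L t = hauptPt (W.baseChange L) P :=
  (InfiniteGalois.mem_range_algebraMap_iff_fixed _).mpr (hauptPt_fixed_of_stable h13 hσ)

/-! ## N1–N3 — the level-13 Tate-normal-form chart (port of the LANDED level-7 theorem) -/

/-- **N1 (S–M).** Every marked curve with a point of order `13` is an `E(rs(r-1), s(r-1))` with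
`F₁₃(r, s) = 0`, `r ∉ {0,1}`, `s ∉ {0,1}`, `r ≠ s`, the point going to `(0,0)`.  Port of
`exists_variableChange_eq_kubertTate_diag₇_of_addOrderOf_eq_seven` (KubertTateSevenNormalForm):
`exists_variableChange_pointEquiv_eq_zero` + `AddEquiv.addOrderOf_eq` +
`kubertTate_addOrderOf_zero_eq_thirteen_iff` (`X₁₃(b,c) = 0`), `c ≠ 0` by `kubertTateX₁₃_zero_right`
(`X₁₃(b,0) = b⁷`), `b ≠ c` by `kubertTateX₁₃_self_self` (`= -b¹¹`), `r := b/c`, `s := c²/(b-c)`,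
`b = rs(r-1)`, `c = s(r-1)` by `field_simp`, `F₁₃ = 0` by `kubertTateX₁₃_eq_mul_raw`; `s ≠ 1`, `r ≠ s`
because `F₁₃(r,1) = (r-1)³`, `F₁₃(r,r) = -r(r-1)⁵`. -/
theorem exists_variableChange_eq_kubertTate_rs_of_addOrderOf_eq_thirteen (W : WeierstrassCurve F)
    {x y : F} (h : W.toAffine.Nonsingular x y) (h13 : addOrderOf (Affine.Point.some x y h) = 13) :
    ∃ (r s : F) (C : VariableChange F) (hC : C • W = kubertTate (r * s * (r - 1)) (s * (r - 1)))
      (h₀ : (kubertTate (r * s * (r - 1)) (s * (r - 1))).toAffine.Nonsingular 0 0),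
      r ≠ 0 ∧ r ≠ 1 ∧ s ≠ 0 ∧ s ≠ 1 ∧ r ≠ s ∧ kubertTateRaw₁₃ r s = 0 ∧
      Affine.Point.congrEquiv hC (VariableChange.pointEquiv W C (.some x y h)) = .some 0 0 h₀ := by
  sorry

/-- **N2 — PROVED.** `(r, s)` read at the origin of `E(rs(r-1), s(r-1))` is `(r, s)`. -/
theorem tateR_tateNine_kubertTate_origin {r s : F} (hr : r ≠ 0) (hr₁ : r ≠ 1) (hs : s ≠ 0) :
    tateR (kubertTate (r * s * (r - 1)) (s * (r - 1))) 0 0 = r ∧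
      (kubertTate (r * s * (r - 1)) (s * (r - 1))).tateNine 0 0 = s := by
  have hr₁' : r - 1 ≠ 0 := sub_ne_zero.mpr hr₁
  have hb : r * s * (r - 1) ≠ 0 := mul_ne_zero (mul_ne_zero hr hs) hr₁'
  have h4 : (kubertTate (r * s * (r - 1)) (s * (r - 1))).a₄ = 0 := rfl
  have h3 : (kubertTate (r * s * (r - 1)) (s * (r - 1))).a₃ ≠ 0 := by
    simp only [kubertTate_a₃, ne_eq, neg_eq_zero]; exact hb
  have hc : s * (r - 1) ≠ 0 := mul_ne_zero hs hr₁'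
  refine ⟨?_, ?_⟩
  · rw [tateR, tgA₁_origin h4 h3, tgA₂_origin h4 h3, tgA₃_origin]
    simp only [kubertTate_a₁, kubertTate_a₂, kubertTate_a₃]
    -- `-(-b)³ / ((-b)((-b) - (1-c)(-b))) = b³/(b²c) = b/c = r`
    have hden : -(r * s * (r - 1)) * (-(r * s * (r - 1)) - (1 - s * (r - 1)) * -(r * s * (r - 1)))
        ≠ 0 := by
      have e : -(r * s * (r - 1)) * (-(r * s * (r - 1)) - (1 - s * (r - 1)) * -(r * s * (r - 1))) =
          (r * s * (r - 1)) ^ 2 * (s * (r - 1)) := by ring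
      rw [e]; exact mul_ne_zero (pow_ne_zero 2 hb) hc
    exact div_eq_of_eq_mul hden (by ring)
  · rw [tateNine_origin h4 h3]
    simp only [kubertTate_a₁, kubertTate_a₂, kubertTate_a₃]
    -- `-(bc)² / (b²(c - b)) = c²/(b - c) = s`
    have hden : (-(r * s * (r - 1))) ^ 3 - (1 - s * (r - 1)) * -(r * s * (r - 1)) * -(r * s * (r - 1))
        + (-(r * s * (r - 1))) ^ 2 ≠ 0 := by
      have e : (-(r * s * (r - 1))) ^ 3 - (1 - s * (r - 1)) * -(r * s * (r - 1)) * -(r * s * (r - 1))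
          + (-(r * s * (r - 1))) ^ 2 = -((r * s * (r - 1)) ^ 2 * (s * (r - 1)) * (r - 1)) := by ring
      rw [e]; exact neg_ne_zero.mpr (mul_ne_zero (mul_ne_zero (pow_ne_zero 2 hb) hc) hr₁')
    exact div_eq_of_eq_mul hden (by ring)

/-- **N3 (S).** In the chart of N1, `(r(P), s(P)) = (r, s)`: `VariableChange.pointEquiv_some`,
`Affine.Point.congrEquiv_some` give `C.toX x = 0`, `C.toY x y = 0`; then g6 B1′ (`tateR_toXY'`,
`tateNine_toXY'`: `(r,s)` is invariant under ANY change of variables; `y ≠ negY` from `2P ≠ 0`)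
and N2. -/
theorem tateR_tateNine_eq_of_chart {x y : F} {h : W.toAffine.Nonsingular x y}
    (h13 : addOrderOf (Affine.Point.some x y h) = 13) {r s : F} {C : VariableChange F}
    (hC : C • W = kubertTate (r * s * (r - 1)) (s * (r - 1)))
    (h₀ : (kubertTate (r * s * (r - 1)) (s * (r - 1))).toAffine.Nonsingular 0 0)
    (hP : Affine.Point.congrEquiv hC (VariableChange.pointEquiv W C (.some x y h)) = .some 0 0 h₀)
    (hr : r ≠ 0) (hr₁ : r ≠ 1) (hs : s ≠ 0) :
    tateR W x y = r ∧ W.tateNine x y = s := by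
  sorry

/-! ## B6′ (S–M) — KF13's conclusion from G8 + N1/N3 + g6 B5/B7 -/

/-- **B6′ (S–M, was M).** A Galois-stable cyclic subgroup of order `13` gives `t ∈ F`, `t ≠ 0`, with
Fricke's `j = (t²+5t+13)(t⁴+7t³+20t²+19t+1)³/t`.  Plan: `t` from `exists_algebraMap_eq_hauptPt` (G8);
`P = (x₀, y₀)`; chart N1 for `W.baseChange L`; `τ(P) = τ(r,s)` (N3); `τ(r,s) ≠ 0`: denominator by g6
B7b, numerator `= (s-1)·A` with `Δ(E(rs(r-1),s(r-1))) = (r-1)⁵r³s⁴·A` (g6 B7a, `ring`) and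
`Δ(C • W) = u⁻¹²Δ(W) ≠ 0`; `j`: `W.map_j`/`variableChange_j` move `W.j` to the normal form, g6 B5
gives `j·τ = G₁₃(τ)` in `L`, `(algebraMap F L).injective` descends it, divide by `t`. -/
theorem exists_hauptmodul_thirteen_of_torsion [IsGalois F L] [W.IsElliptic]
    {P : (W.baseChange L).toAffine.Point} (h13 : addOrderOf P = 13)
    (hσ : ∀ σ : L ≃ₐ[F] L, σ • P ∈ AddSubgroup.zmultiples P) :
    ∃ t : F, t ≠ 0 ∧
      W.j = (t ^ 2 + 5 * t + 13) * (t ^ 4 + 7 * t ^ 3 + 20 * t ^ 2 + 19 * t + 1) ^ 3 / t := by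
  sorry

/-- **Packaging — PROVED modulo B6′** (copy of g6 / level-9 `Isogeny.exists_hauptmodul_nine_of_isCyclic`:
a kernel of prime order `13` is cyclic, generated by `g` of order `13`, and `Γ_K`-stable). -/
theorem exists_hauptmodul_thirteen_of_degree_eq {K : Type u} [Field K] [CharZero K]
    {W W' : WeierstrassCurve K} [W.IsElliptic] (φ : Isogeny W W') (hdeg : φ.degree = 13) :
    ∃ t : K, t ≠ 0 ∧
      W.j = (t ^ 2 + 5 * t + 13) * (t ^ 4 + 7 * t ^ 3 + 20 * t ^ 2 + 19 * t + 1) ^ 3 / t := by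
  haveI : IsGalois K (AlgebraicClosure K) := {}
  haveI : Fact (Nat.Prime 13) := ⟨by decide⟩
  have hcard : Nat.card φ.toAddMonoidHom.ker = 13 := hdeg
  haveI : IsAddCyclic φ.toAddMonoidHom.ker := isAddCyclic_of_prime_card hcard
  obtain ⟨g, hg⟩ := IsAddCyclic.exists_ofOrder_eq_natCard (α := φ.toAddMonoidHom.ker)
  have hordP : addOrderOf (g : W.geomPoints) = 13 := by
    rw [AddSubgroup.addOrderOf_coe, hg]
    exact hdeg
  have hgen : AddSubgroup.zmultiples (g : W.geomPoints) = φ.toAddMonoidHom.ker := by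
    apply AddSubgroup.eq_of_le_of_card_ge (AddSubgroup.zmultiples_le.mpr g.2)
    rw [Nat.card_zmultiples, hordP]
    exact hdeg.le
  have hg0 : φ (g : W.geomPoints) = 0 := (AddMonoidHom.mem_ker).mp g.2
  have hst : ∀ σ : Field.absoluteGaloisGroup K,
      σ • (g : W.geomPoints) ∈ AddSubgroup.zmultiples (g : W.geomPoints) := fun σ => by
    rw [hgen, AddMonoidHom.mem_ker, Isogeny.coe_toAddMonoidHom, φ.map_smul, hg0, smul_zero]
  exact exists_hauptmodul_thirteen_of_torsion (W := W) (L := AlgebraicClosure K)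
    (P := (g : W.geomPoints)) hordP hst

end WeierstrassCurve.KF13

/-! ## KF13 discharged (modulo N1, N3, G4, G5, B6′ here and g6 B3core/B4/B5/B7 inside them) -/

namespace Summit.ABC.ABC.Cruxes.DefiniteRTControlPrime.Sketch.Ideas1g7

open Literature.NumberTheory.EllipticCurves

/-- **KF13** — the named fact `kleinFrickeThirteen_exists_j_eq` (`KleinFrickeLevelThirteen.lean`),
from the gen-7 chain.  Downstream (all PROVED, crux dir `StubIdeasK2G3PastenLemma68.lean`):
`thirteen_not_dvd_degree_freyCurve h13`, `freyIsogenyRadius163 h44 h13 h5`,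
`definiteRTControlPrime_of_cor44_kleinFricke13 hT h44 h13 h5 : DefiniteRTControlPrime`. -/
theorem kleinFrickeThirteen_exists_j_eq_holds : kleinFrickeThirteen_exists_j_eq :=
  fun φ hdeg => WeierstrassCurve.KF13.exists_hauptmodul_thirteen_of_degree_eq φ hdeg

end Summit.ABC.ABC.Cruxes.DefiniteRTControlPrime.Sketch.Ideas1g7

end
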